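import Summits.Ventures.HSemireg.Pad4TowerB1OddBoostBlind

/-!
# THE CEILING-LINE GAME `𝔏_h` — negation lens LINE 6 («ceiling-line-game»), crux `BlochSeedDiscOne` (stmt-HodgeConjecture-18881)

plan-lens-HodgeAV-negation g6, 2026-08-29 (rev 2: + §6′ the kernel rules of the line game; rev 3: + §6″ `X+` only under apex parents; rev 4: §5 same-parity repair after critic memo-40 V). Critic of record idea-crit-6; director-hodge req-36 NEGATION KEY («assume STUB R's seed exists:
the census forces its carrier outside {H₁-static, G₁-closed, ◇₈ (and ◇₁₀)}; construct the forced shape as a typed object s4-search-1 can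
encode, or the typed obstruction»).

## The census law this line types (read ×1 from gs-eng-2 g55's residual instrument, `general-structure/gs2/g55/residual/census.json`
54e0e087dcd02cd5 + `h8/census.json`, kit j322459 STAGE C/B; peel tables j318002 74004db439790926 (◇₁₀), j309861 (◇₈))

Call a letter `x` ON THE CEILING LINE of `◇_h` when `α + c = h` (`OnCeiling h x`, tree): per factor these are the apex `hI` and the
`2·(h∕2)` charged letters `(h−2c)I + cℓ_u`, `1 ≤ c ≤ h∕2`, `u ∈ μ₄` — a four-ray STAR of radius `h∕2` whose rays meet at the apex and end at
the floor corners `(h∕2)ℓ_u`. A support is a LINE SUPPORT when every letter of every present cell (both levels) is on the ceiling line.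
READING (instrument ×1, SAT side = solver-free model replays; tallies (verdict, FC, line) of the 291 ◇₁₀ ∕ 119 ◇₈ peel survivors): ◇₁₀ —
SAT FC: 7 line cells + 1 off-line (`P[6I+ℓ]⁴`, the ◇₈ relic); UNSAT FC: 3, ALL line cells (the two ODD top cells `P[8I+ℓ₋₁³|8I+ℓ_{±i}]` and
the even antipodal-mix cell `P[8I+ℓ₋₁³|8I+ℓ₁]`); SAT non-FC 97 line ∕ 154 off; UNSAT non-FC 8 line ∕ 21 off. ◇₈ — SAT FC: 1 (`P[6I+ℓ]⁴`, a line
cell of height 8); UNSAT FC: 0; non-FC 42+2 line ∕ 68+6 off. SUPPORTS: every one of the 9 SAT fully-charged orbits (8 at ◇₁₀, 1 at ◇₈) is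
realised by a support lying ENTIRELY on ONE ceiling line — 96 of 96 support orbits: full staircases `{5ℓ, 2I+4ℓ, 4I+3ℓ, 6I+2ℓ, 8I+ℓ, 10I}` from
the floor corner to the apex (6 orbits of ◇₁₀: supports of 8, 12, 13, 11, 11, 14 orbits), the `+2I` boost of the ◇₈ staircase (`P[8I+ℓ]⁴`, 8
orbits, no corner letter = `cellRealisable_boost` of `P[6I+ℓ]⁴`), and the ◇₈ staircase of height 8 itself (`P[6I+ℓ]⁴`, 8 orbits, at both
heights). Score of the law «a fully charged cell realisable at height `h` is LINE-realisable at `h` or realisable at `h − 2`»: 9∕9; no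
counter-instance in any booked census row (W16∕W17∕W22∕W25∕W26).

## What this file PROVES (kernel, h-uniform; imports only built `Pad4Tower*` modules)
* §1 the sub-game: `LineSupport h C`, the line target `SeedB1OddLine h` («(TL_h)»: no H₁-static G₁-closed LINE support of height `h` carries
  an odd fully-charged cell), `seedB1OddLine_of_diamond : (T_h) → (TL_h)` and the NEGATION DOORS `¬(TL_h) → ¬(T_h)`, `¬(TL_h) → ¬(T_∞)`:
  an odd static design found in the line game at ANY height kills the all-heights target outright.
* §2 `(TL_h)` is ANTITONE in steps of two (`seedB1OddLine_antitone`): boost a line counterexample by `+2I` (boost blindness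
  `staticH1BoostInvariant_holds`, tree) — so the line game has ONE threshold height, like `(T_h)` (span control).
* §3 THE STAR: inside `◇_h`, from a charged letter on the ceiling line every null partner that is again on the line AND in `◇_h` lies in the
  ANTIPODAL direction `u + 2` of the letter's encoder phase `u` — above (towards the apex) and below (towards the corner) alike
  (`line_partner_dir_above`, `line_partner_dir_below`): each factor of a line support moves on ONE null segment corner → apex.
* §4 `A2I−` IS VACUOUS ON LINE SUPPORTS (`a2iMinusClosed_of_lineSupport`): the `A2I−` partner `q_σ = Z_σ − d·n_u` runs down the letter's OWN
  ray, which leaves the line; hence on line supports `StaticH1 ↔ RuleDMu4Closed ∧ XPlusClosed` (`staticH1_iff_of_lineSupport`) — the kernel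
  face of «`Am`∕`A2I−` contributes 0 clauses to every ◇₁₀ ceiling core» (W25, g55 MUS files) and of W16's split (the `A2I−`-needing odd
  designs of ◇₈ are floor-hung, off the line).
* §5 LINE GENERATION `(LG_h)` — the census law above in HYPOTHESIS FORM (a `def … : Prop`, asserted nowhere) — and the PROVED reduction
  along the SAME-PARITY LADDER `diamond_of_line_of_generation : (∀ n, LG_{h−2n}) → (∀ n, TL_{h−2n}) → (T_h)` (rev 4: rev 1's binder family
  `∀ h' ≤ h` was vacuous at odd heights — critic idea-crit-6 memo-40 V, `not_lineRealisable_of_odd`; repaired here, the proof only ever visited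
  `h, h−2, …`), and `cone_iff_line_of_generation : (∀ m, LG_{2m}) → ((T_∞) ↔ ∀ h, TL_h)`: under line generation the whole odd-cell question
  lives in the line game.
* §6′ (rev 2) THE RULES OF THE LINE GAME AT THE KERNEL: on a line support the own coordinate of a charged `N`-letter is STUCK (no
  server, no cover: both would leave the line, §3), so RULE D-N at a cell with charged letters on two factors FORCES THE OUTWARD DROP of each
  (`line_drop_of_ruleDN`, via the tree engine `settledBelow_of_stuck`); at a fully charged `N`-cell RULE D-N ⟺ the four drops
  (`ruleDN_line_fc_iff_drops`); dually RULE D-P forces the inward lift of EVERY charged letter of EVERY `P`-cell (`line_lift_of_ruleDP'`, the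
  complete `P`-rule: the other factor is charged — control §16 ∕ LINE 5 restated — or the apex, stuck above as well); COROLLARY
  `no_corner_of_two_charged`: no `N`-cell with two charged letters carries the floor corner. Census check on g55's 8 line supports (full
  `G₁`-orbits): N-corner ∕ N-drop ∕ P-lift violations 0 ∕ 0 ∕ 0.
* §6″ (rev 3) `X+` ON A LINE SUPPORT FIRES ONLY UNDER AN APEX PARENT (`xPlus_parent_apex_of_lineSupport`, kernel, no breaker used): the
  parent `q ∈ lower` of an `X+` instance has two `P`-children below it on `σ` in two different directions; a charged line letter has one ray.
  With §4 and §6′ the RULES OF THE LINE GAME are kernel on both levels: lifts ∕ drops at cells with two charged letters, the tree's RULE D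
  verbatim at apex factors, `X+` = rivalry under apex parents, `G₁`.
* §6 `decide` probes: the census cells named above are line cells at the stated heights; the two odd top cells are odd (`OddPat`) FC line cells.

## What it does NOT say
Nothing here asserts `(T_h)`, `(TL_h)` for any `h ≥ 12`, `(LG_h)`, H2 = `BlochSeedDiscOne`, stmt-18881, HC, HC_CM or HC_AV; HC_CM is
nobody's hypothesis here. `(TL_8)`, `(TL_10)` hold at MACHINE level only (they are weaker than the booked UNSAT rows W17∕W22: line-SAT ⇒ ◇-SAT by
support inclusion, replay-checked per support). Machine ≠ kernel. The NEGATION BET of the line is the cheap monotone ladder W-LINE-h (card):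
the line alphabet has `2h + 1` letters against `◇_h`'s `(h∕2+1)(h+1)`… so heights `12 … 20` cost less than one ◇₈ row each.
-/

namespace Summit.HodgeConjecture.HodgeConjecture.Cruxes.BlochSeedDiscOne.CeilingLine

set_option linter.dupNamespace false

open Summit.Ventures.HSemireg Summit.Ventures.HSemireg.Pad4Tower

/-! ## §1 The line sub-game and the negation doors -/

/-- **LINE SUPPORT of height `h`**: every letter of every present cell, on both levels, lies on the ceiling line `α + c = h`. Decidable. -/
abbrev LineSupport (h : ℤ) (C : MConfig) : Prop :=
  (∀ Z ∈ C.lower, ∀ f, OnCeiling h (Z f)) ∧ ∀ P ∈ C.upper, ∀ f, OnCeiling h (P f)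

/-- **(TL_h) THE LINE TARGET**: no H₁-static, G₁-closed LINE support inside `◇_h` carries an odd fully-charged cell. (Weaker than `(T_h)`;
its NEGATION at any height refutes `(T_h)` and `(T_∞)`, §1.) -/
def SeedB1OddLine (h : ℤ) : Prop :=
  ∀ C : MConfig, C.InDiamond h → LineSupport h C → C.G1Closed → C.StaticH1 → ¬ C.HasOddFC

/-- `(T_h) → (TL_h)`: the line game is a sub-game. -/
theorem seedB1OddLine_of_diamond {h : ℤ} (H : SeedB1OddDiamondG1H1 h) : SeedB1OddLine h :=
  fun C hU _ hG hS => H C hU hG hS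

/-- **NEGATION DOOR 1**: an odd static line design of height `h` refutes `(T_h)`. -/
theorem not_diamond_of_not_line {h : ℤ} (H : ¬ SeedB1OddLine h) : ¬ SeedB1OddDiamondG1H1 h :=
  fun H' => H (seedB1OddLine_of_diamond H')

/-- **NEGATION DOOR 2**: an odd static line design of ANY height refutes the all-heights target `(T_∞)` (`SeedB1OddConeG1H1`). -/
theorem not_cone_of_not_line {h : ℤ} (H : ¬ SeedB1OddLine h) : ¬ SeedB1OddConeG1H1 :=
  fun H' => H (fun C hU _ hG hS => H' C (inCone_of_inDiamond' hU) hG hS)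

/-- `(T_{h'}) → (TL_h)` for `h ≤ h'` (compose with `(MONO)`). -/
theorem seedB1OddLine_of_diamond_le {h h' : ℤ} (hh : h ≤ h') (H : SeedB1OddDiamondG1H1 h') : SeedB1OddLine h :=
  seedB1OddLine_of_diamond (seedB1OddDiamondG1H1_antitone hh H)

/-! ## §2 One threshold: `(TL_h)` is antitone in steps of two (boost blindness) -/

/-- the boost by `s` carries the ceiling line of height `h` onto the one of height `h + s`. -/
theorem onCeiling_boostPt_iff (h s : ℤ) (x : BPoint) : OnCeiling (h + s) (boostPt s x) ↔ OnCeiling h x := by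
  obtain ⟨a, b1, b2⟩ := x
  simp only [OnCeiling, absCharge, chargeOf]
  omega

/-- line supports boost to line supports. -/
theorem lineSupport_boostImage_iff (h s : ℤ) (C : MConfig) : LineSupport (h + s) (C.boostImage s) ↔ LineSupport h C := by
  constructor
  · rintro ⟨hl, hu⟩
    refine ⟨fun Z hZ f => ?_, fun P hP f => ?_⟩
    · have := hl (Z.boost s) (Finset.mem_image_of_mem _ hZ) f
      exact (onCeiling_boostPt_iff h s (Z f)).mp this
    · have := hu (P.boost s) (Finset.mem_image_of_mem _ hP) f
      exact (onCeiling_boostPt_iff h s (P f)).mp this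
  · rintro ⟨hl, hu⟩
    refine ⟨fun W hW f => ?_, fun W hW f => ?_⟩
    · obtain ⟨Z, hZ, rfl⟩ := Finset.mem_image.mp hW
      exact (onCeiling_boostPt_iff h s (Z f)).mpr (hl Z hZ f)
    · obtain ⟨P, hP, rfl⟩ := Finset.mem_image.mp hW
      exact (onCeiling_boostPt_iff h s (P f)).mpr (hu P hP f)

/-- **`(TL_{h+2}) → (TL_h)`**: boost a line counterexample of height `h` by `+2I` (boost blindness of H₁, G₁ and odd-FC presence, tree §7). -/
theorem seedB1OddLine_antitone_two {h : ℤ} (H : SeedB1OddLine (h + 2)) : SeedB1OddLine h := by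
  intro C hU hL hG hS hodd
  have hU' := inDiamond_boostImage_two hU
  obtain ⟨hSi, hGi, hOi⟩ := staticH1BoostInvariant_holds 2 C (inCone_of_inDiamond' hU) (inCone_of_inDiamond' hU')
  exact H (C.boostImage 2) hU' ((lineSupport_boostImage_iff h 2 C).mpr hL) (hGi.mp hG) (hSi.mp hS) (hOi.mp hodd)

/-- **`(TL_{h+2n}) → (TL_h)`**: the heights at which the line game is odd-free form a DOWN-SET in steps of two — one threshold. -/
theorem seedB1OddLine_antitone {h : ℤ} (n : ℕ) (H : SeedB1OddLine (h + 2 * n)) : SeedB1OddLine h := by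
  induction n generalizing h with
  | zero => simpa using H
  | succ n ih =>
    apply ih
    apply seedB1OddLine_antitone_two
    have e : h + 2 * (n : ℤ) + 2 = h + 2 * ((n + 1 : ℕ) : ℤ) := by push_cast; ring
    rw [e]; exact H

/-! ## §3 The star: on-line partners of a charged line letter run along the antipodal direction only -/

/-- the encoder phase of a charged letter of the cone: `β = c·(phase vector of u)` with `c = cabs ≥ 1`. -/
theorem encDir_shape {h : ℤ} {x : BPoint} {u : Fin 4} (hx : InDiamond h x) (hna : ¬ isApex x) (hE : EncDir x u) :
    1 ≤ cabs x ∧ x.2.1 = cabs x * ![1, 0, -1, 0] u ∧ x.2.2 = cabs x * ![0, -1, 0, 1] u := by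
  obtain ⟨a, b1, b2⟩ := x
  obtain ⟨hax, hca, -, -⟩ := hx
  have hc0 : 0 ≤ cabs (a, b1, b2) := le_max_of_le_left (abs_nonneg _)
  have hab : 0 ≤ absCharge (a, b1, b2) := abs_nonneg _
  rcases hE with ⟨-, hr⟩ | ⟨hneg, -⟩
  · simp only [ray, Prod.mk.injEq] at hr
    obtain ⟨-, hr1, hr2⟩ := hr
    have h1 : b1 = cabs (a, b1, b2) * ![1, 0, -1, 0] u := by linarith
    have h2 : b2 = cabs (a, b1, b2) * ![0, -1, 0, 1] u := by linarith
    refine ⟨?_, h1, h2⟩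
    rcases (lt_or_eq_of_le hc0) with hlt | heq
    · omega
    · exfalso
      apply hna
      simp only [isApex]
      rw [← heq] at h1 h2
      constructor
      · simpa using h1
      · simpa using h2
  · exfalso
    simp only at hneg
    omega

/-- the causal height `α + c` of a letter with `β = c·(phase vector of u)`, `c ≥ 0`, is `α + c`. -/
theorem absCharge_of_shape {c : ℤ} (hc : 0 ≤ c) (a : ℤ) (u : Fin 4) :
    absCharge (a, c * ![1, 0, -1, 0] u, c * ![0, -1, 0, 1] u) = c := by
  have h1 : |c| = c := abs_of_nonneg hc
  have h2 : |-c| = c := by rw [abs_neg]; exact h1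
  fin_cases u <;> simp [absCharge, chargeOf, h1, h2]

/-- **BELOW a charged line letter, on-line partners of `◇_h` lie in direction `u + 2` only** (they are the DEEPER letters of the same phase:
the star's ray through the letter). -/
theorem line_partner_dir_below {h : ℤ} {x y : BPoint} {u k : Fin 4}
    (hx : InDiamond h x) (hxc : OnCeiling h x) (hna : ¬ isApex x) (hE : EncDir x u)
    (hy : InDiamond h y) (hyc : OnCeiling h y) (hlt : y.1 < x.1) (hray : x = ray y k (x.1 - y.1)) : k = u + 2 := by
  obtain ⟨hc1, hb1, hb2⟩ := encDir_shape hx hna hE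
  have hay := hy.1
  clear hx hy hna hE
  obtain ⟨a, b1, b2⟩ := x
  obtain ⟨a', b1', b2'⟩ := y
  simp only [ray, Prod.mk.injEq] at hray
  obtain ⟨-, hr1, hr2⟩ := hray
  generalize hcdef : cabs (a, b1, b2) = c at hc1 hb1 hb2
  clear hcdef
  simp only at hb1 hb2 hlt hr1 hr2
  simp only [OnCeiling, absCharge, chargeOf, Int.abs_eq_natAbs] at hxc hyc
  fin_cases u <;> fin_cases k <;> simp [AxisPt] at hb1 hb2 hr1 hr2 hay ⊢ <;> omega

/-- **ABOVE a charged line letter, partners inside `◇_h` lie in direction `u + 2` only** (towards the apex; the form of control's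
`above_ceiling_letter` (B1OddTowerLaws §16) in encoder-phase clothing, re-proved here because `Cruxes` modules are not importable). -/
theorem line_partner_dir_above {h : ℤ} {x y : BPoint} {u k : Fin 4}
    (hx : InDiamond h x) (hxc : OnCeiling h x) (hna : ¬ isApex x) (hE : EncDir x u)
    (hy : InDiamond h y) (hlt : x.1 < y.1) (hray : y = ray x k (y.1 - x.1)) : k = u + 2 := by
  obtain ⟨hc1, hb1, hb2⟩ := encDir_shape hx hna hE
  have hay := hy.1
  have hA := hy.2.2.2
  clear hx hy hna hE
  obtain ⟨a, b1, b2⟩ := x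
  obtain ⟨a', b1', b2'⟩ := y
  simp only [ray, Prod.mk.injEq] at hray
  obtain ⟨-, hr1, hr2⟩ := hray
  generalize hcdef : cabs (a, b1, b2) = c at hc1 hb1 hb2
  clear hcdef
  simp only at hb1 hb2 hlt hr1 hr2
  simp only [OnCeiling, absCharge, chargeOf, Int.abs_eq_natAbs] at hxc hA
  fin_cases u <;> fin_cases k <;> simp [AxisPt] at hb1 hb2 hr1 hr2 hay ⊢ <;> omega

/-- in particular **the OWN ray downwards leaves the line**: a `u`-partner strictly below a charged line letter with encoder phase `u`
is never on the ceiling line. -/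
theorem own_ray_below_offLine {h : ℤ} {x y : BPoint} {u : Fin 4}
    (hx : InDiamond h x) (hxc : OnCeiling h x) (hna : ¬ isApex x) (hE : EncDir x u)
    (hy : InDiamond h y) (hlt : y.1 < x.1) (hray : x = ray y u (x.1 - y.1)) : ¬ OnCeiling h y := by
  intro hyc
  have := line_partner_dir_below hx hxc hna hE hy hyc hlt hray
  revert this; fin_cases u <;> decide

/-! ## §4 `A2I−` is vacuous on line supports; `H₁` on the line is `RULE D + X+` -/

/-- **`A2I−` IS CLOSED ON EVERY LINE SUPPORT inside `◇_h`**: an `A2I−` instance needs a `u`-partner `q ∈ upper` strictly below the head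
letter along its OWN phase `u` (`EncDir (Z σ) u`, `UPartner Z q σ u`); on the line no such `q_σ` exists (§3). No RULE D, no `X+`, no census. -/
theorem a2iMinusClosed_of_lineSupport {h : ℤ} {C : MConfig} (hU : C.InDiamond h) (hL : LineSupport h C) : A2IMinusClosed C := by
  intro Z hZ q hq N' _ σ u f' v hF
  obtain ⟨hna, hE, ⟨-, hlt, hray⟩, -⟩ := hF
  exact own_ray_below_offLine (hU.1 Z hZ σ) (hL.1 Z hZ σ) hna hE (hU.2 q hq σ) hlt hray (hL.2 q hq σ)

/-- hence **on line supports `StaticH1 ↔ RuleDMu4Closed ∧ XPlusClosed`**: the line game is played with TWO families. -/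
theorem staticH1_iff_of_lineSupport {h : ℤ} {C : MConfig} (hU : C.InDiamond h) (hL : LineSupport h C) :
    C.StaticH1 ↔ RuleDMu4Closed C ∧ XPlusClosed C :=
  ⟨fun hS => ⟨hS.1, hS.2.1⟩, fun hS => ⟨hS.1, hS.2, a2iMinusClosed_of_lineSupport hU hL⟩⟩

/-- the line target restated with two families (what a line-game encoder has to implement: RULE D, `X+`, `G₁`, odd-FC presence). -/
theorem seedB1OddLine_iff_two_families (h : ℤ) :
    SeedB1OddLine h ↔ ∀ C : MConfig, C.InDiamond h → LineSupport h C → C.G1Closed → RuleDMu4Closed C → XPlusClosed C → ¬ C.HasOddFC :=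
  ⟨fun H C hU hL hG hD hX => H C hU hL hG ((staticH1_iff_of_lineSupport hU hL).mpr ⟨hD, hX⟩),
    fun H C hU hL hG hS => H C hU hL hG hS.1 hS.2.1⟩

/-! ## §5 LINE GENERATION (hypothesis form) and the proved reduction of `(T_h)` to the line targets -/

/-- the cell `Z` is LINE-REALISABLE at height `h` (on the lower level iff `lowerLevel`): it lies on some H₁-static G₁-closed LINE support of `◇_h`. -/
def LineRealisable (h : ℤ) (lowerLevel : Bool) (Z : MCell) : Prop :=
  ∃ C : MConfig, C.InDiamond h ∧ LineSupport h C ∧ C.G1Closed ∧ C.StaticH1 ∧ (if lowerLevel then Z ∈ C.lower else Z ∈ C.upper)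

/-- line-realisable cells are realisable (`CellRealisable`, tree §9). -/
theorem cellRealisable_of_lineRealisable {h : ℤ} {b : Bool} {Z : MCell} (H : LineRealisable h b Z) : CellRealisable h b Z := by
  obtain ⟨C, hU, -, hG, hS, hZ⟩ := H
  exact ⟨C, hU, hG, hS, hZ⟩

/-- **(LG_h) LINE GENERATION at height `h` — CONJECTURE, hypothesis form, asserted nowhere.** Every fully-charged cell realisable at height
`h` is LINE-realisable at height `h` or already realisable at height `h − 2`. Census score 9∕9 (◇₈: 1∕1, ◇₁₀: 8∕8 fully-charged SAT orbits;
g55 residual instrument, model replays solver-free); the cheapest falsifier is any realisable FC orbit whose every realising support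
leaves the line while the orbit is not realisable two rungs down. -/
def LineGeneration (h : ℤ) : Prop :=
  ∀ (b : Bool) (Z : MCell), FCc Z → CellRealisable h b Z → LineRealisable h b Z ∨ CellRealisable (h - 2) b Z

/-- realisability needs a non-negative height (a letter of `◇_h` has `0 ≤ c ≤ α` and `α + c ≤ h`). -/
theorem height_nonneg_of_cellRealisable {h : ℤ} {b : Bool} {Z : MCell} (H : CellRealisable h b Z) : 0 ≤ h := by
  obtain ⟨C, hU, -, -, hZ⟩ := H
  have hx : InDiamond h (Z 0) := by
    cases b
    · simp only [Bool.false_eq_true, ↓reduceIte] at hZ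
      exact hU.2 Z hZ 0
    · simp only [↓reduceIte] at hZ
      exact hU.1 Z hZ 0
  have h0 : 0 ≤ absCharge (Z 0) := abs_nonneg _
  have h1 := hx.2.1
  have h2 := hx.2.2.2
  omega

/-- **PARITY** (critic idea-crit-6 g7, memo-40 V; repair of rev 1's binder family): every letter of `◇_h` has `α + c` EVEN (`(α − c) % 2 = 0` is a
clause of `InDiamond`), so at an ODD height no cell is line-realisable — `(LG)` and `(TL)` must be read along the SAME-PARITY LADDER `h, h−2, h−4, …`
(rev 1 quantified over all `h' ≤ h`, a family that is machine-false at odd heights and made the rev-1 reduction vacuous; the proof only ever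
visited `h, h−2, …`). -/
theorem not_lineRealisable_of_odd {h : ℤ} (hh : h % 2 = 1) (b : Bool) (Z : MCell) : ¬ LineRealisable h b Z := by
  rintro ⟨C, hU, hL, -, -, hZ⟩
  have key : ∀ x : BPoint, InDiamond h x → OnCeiling h x → False := by
    intro x hx hc
    have h1 : (x.1 - absCharge x) % 2 = 0 := hx.2.2.1
    have h2 : x.1 + absCharge x = h := hc
    omega
  cases b
  · simp only [Bool.false_eq_true, ↓reduceIte] at hZ
    exact key (Z 0) (hU.2 Z hZ 0) (hL.2 Z hZ 0)
  · simp only [↓reduceIte] at hZ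
    exact key (Z 0) (hU.1 Z hZ 0) (hL.1 Z hZ 0)

/-- the engine of the reduction along the ladder: under `(LG_{h−2n})` and `(TL_{h−2n})` for all `n`, an odd fully-charged cell is realisable at no
rung `h − 2n` (proof shape: critic's appendix-clg1b, the line's rev-1 engine re-run on the ladder). -/
theorem not_cellRealisable_of_line_ladder {h : ℤ} (G : ∀ n : ℕ, LineGeneration (h - 2 * n)) (L : ∀ n : ℕ, SeedB1OddLine (h - 2 * n))
    {b : Bool} {Z : MCell} (hfc : FCc Z) (hodd : OddPat Z.pat) :
    ∀ N : ℕ, ∀ n : ℕ, h - 2 * n < N → ¬ CellRealisable (h - 2 * n) b Z := by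
  intro N
  induction N with
  | zero =>
    intro n hn H
    have := height_nonneg_of_cellRealisable H
    push_cast at hn
    omega
  | succ N ih =>
    intro n hn H
    rcases G n b Z hfc H with HL | Hdown
    · obtain ⟨C', hU', hL', hG', hS', hZ'⟩ := HL
      apply L n C' hU' hL' hG' hS'
      cases b
      · simp only [Bool.false_eq_true, ↓reduceIte] at hZ'
        exact Or.inr ⟨Z, hZ', hfc, hodd⟩
      · simp only [↓reduceIte] at hZ'
        exact Or.inl ⟨Z, hZ', hfc, hodd⟩
    · have e : h - 2 * (n : ℤ) - 2 = h - 2 * ((n + 1 : ℕ) : ℤ) := by push_cast; ring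
      rw [e] at Hdown
      push_cast at hn
      exact ih (n + 1) (by push_cast; omega) Hdown

/-- **THE REDUCTION (PROVED, same-parity ladder form)**: line generation and the line targets along `h, h−2, h−4, …` give `(T_h)`. Under `(LG)`
the odd-cell question for ◇-supports IS the odd-cell question for line supports. -/
theorem diamond_of_line_of_generation {h : ℤ} (G : ∀ n : ℕ, LineGeneration (h - 2 * n))
    (L : ∀ n : ℕ, SeedB1OddLine (h - 2 * n)) : SeedB1OddDiamondG1H1 h := by
  intro C hU hG hS hodd
  have hn : h - 2 * ((0 : ℕ) : ℤ) < ((h.toNat + 1 : ℕ) : ℤ) := by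
    have := Int.self_le_toNat h
    push_cast
    omega
  have e0 : h - 2 * ((0 : ℕ) : ℤ) = h := by push_cast; ring
  rcases hodd with ⟨Z, hZ, hfc, hp⟩ | ⟨P, hP, hfc, hp⟩
  · have := not_cellRealisable_of_line_ladder G L (b := true) hfc hp (h.toNat + 1) 0 hn
    rw [e0] at this
    exact this ⟨C, hU, hG, hS, by simpa using hZ⟩
  · have := not_cellRealisable_of_line_ladder G L (b := false) hfc hp (h.toNat + 1) 0 hn
    rw [e0] at this
    exact this ⟨C, hU, hG, hS, by simpa using hP⟩

/-- rev 1's binder form (`∀ h' ≤ h`) is the weaker statement: it follows by specialisation (but its hypothesis family is vacuous at odd heights). -/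
example {h : ℤ} (G : ∀ h', h' ≤ h → LineGeneration h') (L : ∀ h', h' ≤ h → SeedB1OddLine h') : SeedB1OddDiamondG1H1 h :=
  diamond_of_line_of_generation (fun n => G _ (by omega)) (fun n => L _ (by omega))

/-- and at ALL heights: `(LG)` at every EVEN height makes `(T_∞)` equivalent to the family of line targets (odd heights by antitonicity of `(T_h)`). -/
theorem cone_iff_line_of_generation (G : ∀ m : ℤ, LineGeneration (2 * m)) :
    SeedB1OddConeG1H1 ↔ ∀ h, SeedB1OddLine h := by
  constructor
  · intro H h
    exact fun C hU _ hG hS => H C (inCone_of_inDiamond' hU) hG hS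
  · intro L
    rw [show SeedB1OddConeG1H1 ↔ ∀ h : ℤ, SeedB1OddDiamondG1H1 h from seedB1OddConeIff]
    have heven : ∀ k : ℤ, SeedB1OddDiamondG1H1 (2 * k) := fun k =>
      diamond_of_line_of_generation
        (fun n => by
          have e : (2 : ℤ) * (k - n) = 2 * k - 2 * n := by ring
          have := G (k - n)
          rwa [e] at this)
        (fun n => L _)
    intro h
    rcases Int.emod_two_eq_zero_or_one h with he | ho
    · obtain ⟨k, hk⟩ : ∃ k, h = 2 * k := ⟨h / 2, by omega⟩
      rw [hk]; exact heven k
    · obtain ⟨k, hk⟩ : ∃ k, h + 1 = 2 * k := ⟨(h + 1) / 2, by omega⟩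
      exact seedB1OddDiamondG1H1_antitone (show h ≤ h + 1 by omega) (hk ▸ heven k)

/-! ## §6′ The rules of the line game at the kernel: RULE D at two charged line letters = outward drops ∕ inward lifts

(First lemma (b) of the card rev 1, now proved.) Frame facts of a charged cone letter `x` with encoder phase `u` (`EncDir x u`): it is
adapted exactly to the frame `{u, u+2}`, its OWN coordinate is `coord x u = x.1 + cabs x` (`= h` on the ceiling line) and its
ANTIPODAL coordinate is `coord x (u+2) = x.1 - cabs x ≤ h - 2`. On a LINE support the own coordinate of a charged letter of an
`N`-cell is STUCK (§3: a server below would sit on the own ray, off the line; a cover would move the letter down its own ray, `DirOK`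
allowing no other direction at a non-apex point), so the engine `settledBelow_of_stuck` forces, at every `N`-cell carrying charged letters
on TWO factors `g ≠ j`, the antipodal coordinate of `j` to be settled below — and on the line «settled» means served in direction
`u_j + 2` exactly: the DROP `Z[j ↦ deeper letter of the same phase]` is present. Conversely at a fully charged `N`-cell the four drops
discharge every RULE D-N demand (own∕own pairs have equal coordinates `h = h`). Dually RULE D-P forces the inward LIFTS (control's
`antipodalServer_of_ceiling_letter`, B1OddTowerLaws §16, and LINE 5's `ruleDP_ceiling_iff_lifts`, restated for cells with two charged
letters on line supports because `Cruxes` modules are not importable). COROLLARY: on a line support no `N`-cell with two charged letters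
carries the floor corner `(h∕2)·ℓ_u` (its drop would leave `◇_h`). Census check (g55 `models∕model-res-*.txt`, all 8 line supports, full
`G₁`-orbits, 20-line script): N-corner 0 ∕ N-drop 0 ∕ P-lift 0 violations. -/

section LineRules

theorem fin4_ne_add_two (w : Fin 4) : w ≠ w + 2 := by fin_cases w <;> decide

theorem fin4_add_one_ne (w : Fin 4) : w + 1 ≠ w := by fin_cases w <;> decide

variable {x : BPoint} {u : Fin 4}

/-- a charged letter of shape `(a, c·r(u))` is adapted to `u` and to `u + 2` … -/
theorem adapted_of_shape (hb1 : x.2.1 = cabs x * ![1, 0, -1, 0] u) (hb2 : x.2.2 = cabs x * ![0, -1, 0, 1] u) :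
    Adapted x u ∧ Adapted x (u + 2) := by
  obtain ⟨a, b1, b2⟩ := x
  generalize hcdef : cabs (a, b1, b2) = c at hb1 hb2
  clear hcdef
  simp only at hb1 hb2
  subst hb1 hb2
  fin_cases u <;> simp [Adapted]

/-- … and to no other direction. -/
theorem adapted_cases_of_shape (hc1 : 1 ≤ cabs x) (hb1 : x.2.1 = cabs x * ![1, 0, -1, 0] u)
    (hb2 : x.2.2 = cabs x * ![0, -1, 0, 1] u) {k : Fin 4} (hk : Adapted x k) : k = u ∨ k = u + 2 := by
  obtain ⟨a, b1, b2⟩ := x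
  generalize hcdef : cabs (a, b1, b2) = c at hc1 hb1 hb2
  clear hcdef
  simp only at hb1 hb2
  subst hb1 hb2
  fin_cases u <;> fin_cases k <;> simp [Adapted] at hk ⊢ <;> omega

/-- the own and the antipodal coordinate of a charged letter of shape `(a, c·r(u))`. -/
theorem coord_of_shape (hb1 : x.2.1 = cabs x * ![1, 0, -1, 0] u) (hb2 : x.2.2 = cabs x * ![0, -1, 0, 1] u) :
    coord x u = x.1 + cabs x ∧ coord x (u + 2) = x.1 - cabs x := by
  obtain ⟨a, b1, b2⟩ := x
  generalize hcdef : cabs (a, b1, b2) = c at hb1 hb2 ⊢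
  clear hcdef
  simp only at hb1 hb2 ⊢
  subst hb1 hb2
  fin_cases u <;> simp [coord] <;> ring

/-- `absCharge = cabs` at a charged letter of shape `(a, c·r(u))`. -/
theorem absCharge_eq_cabs_of_shape (hc1 : 1 ≤ cabs x) (hb1 : x.2.1 = cabs x * ![1, 0, -1, 0] u)
    (hb2 : x.2.2 = cabs x * ![0, -1, 0, 1] u) : absCharge x = cabs x := by
  obtain ⟨a, b1, b2⟩ := x
  generalize hcdef : cabs (a, b1, b2) = c at hc1 hb1 hb2 ⊢
  clear hcdef
  simp only at hb1 hb2 ⊢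
  subst hb1 hb2
  exact absCharge_of_shape (by omega) a u

/-- every charged letter of the cone has an encoder phase. -/
theorem exists_encDir {h : ℤ} {x : BPoint} (hx : InDiamond h x) (hna : ¬ isApex x) : ∃ u, EncDir x u := by
  obtain ⟨a, b1, b2⟩ := x
  obtain ⟨hax, hca, -, -⟩ := hx
  have hab : (0 : ℤ) ≤ absCharge (a, b1, b2) := abs_nonneg _
  have ha : 0 ≤ a := le_trans hab hca
  simp only [isApex, not_and_or] at hna
  rcases hax with h0 | ⟨hb1, hb2⟩ | ⟨hb1, hb2⟩
  · exfalso
    simp only [Prod.mk.injEq] at h0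
    omega
  · simp only at hb1 hb2
    subst hb2
    rcases lt_or_gt_of_ne hb1 with hneg | hpos
    · refine ⟨2, Or.inl ⟨ha, ?_⟩⟩
      have hc : cabs (a, b1, (0 : ℤ)) = -b1 := by simp [cabs, abs_of_neg hneg, hneg.le]
      rw [hc]; simp [ray]
    · refine ⟨0, Or.inl ⟨ha, ?_⟩⟩
      have hc : cabs (a, b1, (0 : ℤ)) = b1 := by simp [cabs, abs_of_pos hpos, hpos.le]
      rw [hc]; simp [ray]
  · simp only at hb1 hb2
    subst hb1
    rcases lt_or_gt_of_ne hb2 with hneg | hpos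
    · refine ⟨1, Or.inl ⟨ha, ?_⟩⟩
      have hc : cabs (a, (0 : ℤ), b2) = -b2 := by simp [cabs, abs_of_neg hneg, hneg.le]
      rw [hc]; simp [ray]
    · refine ⟨3, Or.inl ⟨ha, ?_⟩⟩
      have hc : cabs (a, (0 : ℤ), b2) = b2 := by simp [cabs, abs_of_pos hpos, hpos.le]
      rw [hc]; simp [ray]

variable {h : ℤ} {C : MConfig}

/-- on a line support the own coordinate of a charged letter of an `N`-cell is never SETTLED below (§3: servers run along `u+2`). -/
theorem own_not_settledBelow (hU : C.InDiamond h) (hL : LineSupport h C) {Z : MCell} (hZ : Z ∈ C.lower) {g : Fin 4}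
    (hna : ¬ isApex (Z g)) {u : Fin 4} (hE : EncDir (Z g) u) : ¬ SettledBelow C Z g u := by
  rintro ⟨r, hr, P, hP, -, hlt, hray⟩
  exact hr (line_partner_dir_below (hU.1 Z hZ g) (hL.1 Z hZ g) hna hE (hU.2 P hP g) (hL.2 P hP g) hlt hray)

/-- … nor COVERABLE below: `DirOK` at a non-apex letter allows only the direction `u` itself, a cover down the own ray, off the line. -/
theorem own_not_coveredBelow (hU : C.InDiamond h) (hL : LineSupport h C) {Z : MCell} (hZ : Z ∈ C.lower) {g : Fin 4}
    (hna : ¬ isApex (Z g)) {u : Fin 4} (hE : EncDir (Z g) u) (j k' : Fin 4) : ¬ CoveredBelow C Z g u j k' := by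
  rintro ⟨a, b, hdir, -, P, hP, -, hlt, hray, -⟩
  rcases hdir with rfl | ⟨hap, -⟩
  · exact own_ray_below_offLine (hU.1 Z hZ g) (hL.1 Z hZ g) hna hE (hU.2 P hP g) hlt hray (hL.2 P hP g)
  · exact hna hap

/-- **THE `N`-RULE OF THE LINE GAME (kernel).** On a line support inside `◇_h`, at an `N`-cell passing RULE D-N with charged letters on
two factors `g ≠ j`, the factor `j` is served below in its antipodal direction `u_j + 2`: the DROP `Z[j ↦ deeper]` is present. -/
theorem line_drop_of_ruleDN (hU : C.InDiamond h) (hL : LineSupport h C) {Z : MCell} (hZ : Z ∈ C.lower) (hD : RuleDMu4N C Z)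
    {g j : Fin 4} (hgj : g ≠ j) (hg : ¬ isApex (Z g)) (hj : ¬ isApex (Z j)) {v : Fin 4} (hEj : EncDir (Z j) v) :
    MServedBelow C Z j (v + 2) := by
  obtain ⟨u, hEg⟩ := exists_encDir (hU.1 Z hZ g) hg
  obtain ⟨hcg, hg1, hg2⟩ := encDir_shape (hU.1 Z hZ g) hg hEg
  obtain ⟨hcj, hj1, hj2⟩ := encDir_shape (hU.1 Z hZ j) hj hEj
  have hgc : (Z g).1 + absCharge (Z g) = h := hL.1 Z hZ g
  have hjc : (Z j).1 + absCharge (Z j) = h := hL.1 Z hZ j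
  rw [absCharge_eq_cabs_of_shape hcg hg1 hg2] at hgc
  rw [absCharge_eq_cabs_of_shape hcj hj1 hj2] at hjc
  have hne : coord (Z j) (v + 2) ≠ coord (Z g) u := by
    rw [(coord_of_shape hj1 hj2).2, (coord_of_shape hg1 hg2).1]; omega
  obtain ⟨r, -, P, hP, hPa⟩ := settledBelow_of_stuck hD (adapted_of_shape hg1 hg2).1 (own_not_settledBelow hU hL hZ hg hEg)
    (own_not_coveredBelow hU hL hZ hg hEg) hgj.symm (adapted_of_shape hj1 hj2).2 hne
  have hr := line_partner_dir_below (hU.1 Z hZ j) (hL.1 Z hZ j) hj hEj (hU.2 P hP j) (hL.2 P hP j) hPa.2.1 hPa.2.2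
  subst hr
  exact ⟨P, hP, hPa⟩

/-- **COROLLARY: no corner letters.** A letter served below on a line support is not on the floor; hence on a line support no `N`-cell
passing RULE D-N with charged letters on two factors carries the floor corner `(h∕2)·ℓ_u`. -/
theorem not_onFloor_of_servedBelow (hU : C.InDiamond h) (hL : LineSupport h C) {Z : MCell} (hZ : Z ∈ C.lower) {j k : Fin 4}
    (hs : MServedBelow C Z j k) : ¬ OnFloor (Z j) := by
  obtain ⟨P, hP, -, hlt, -⟩ := hs
  intro hfl
  have h1 : (Z j).1 + absCharge (Z j) = h := hL.1 Z hZ j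
  have h2 : (P j).1 + absCharge (P j) = h := hL.2 P hP j
  have h3 : absCharge (P j) ≤ (P j).1 := (hU.2 P hP j).2.1
  have h4 : (Z j).1 = absCharge (Z j) := hfl
  omega

theorem no_corner_of_two_charged (hU : C.InDiamond h) (hL : LineSupport h C) {Z : MCell} (hZ : Z ∈ C.lower) (hD : RuleDMu4N C Z)
    {g j : Fin 4} (hgj : g ≠ j) (hg : ¬ isApex (Z g)) (hj : ¬ isApex (Z j)) : ¬ OnFloor (Z j) := by
  obtain ⟨v, hEj⟩ := exists_encDir (hU.1 Z hZ j) hj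
  exact not_onFloor_of_servedBelow hU hL hZ (line_drop_of_ruleDN hU hL hZ hD hgj hg hj hEj)

/-- conversely, at a FULLY CHARGED `N`-cell of a line support the four drops discharge RULE D-N. -/
theorem ruleDN_of_line_drops (hU : C.InDiamond h) (hL : LineSupport h C) {Z : MCell} (hZ : Z ∈ C.lower)
    (hfc : ∀ f, ¬ isApex (Z f)) (u : Fin 4 → Fin 4) (hE : ∀ f, EncDir (Z f) (u f))
    (hdrop : ∀ j, MServedBelow C Z j (u j + 2)) : RuleDMu4N C Z := by
  have hset : ∀ f, SettledBelow C Z f (u f + 2) := fun f => ⟨u f + 2, fin4_ne_add_two (u f + 2), hdrop f⟩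
  intro g j hgj k k' hk hk' hne
  obtain ⟨hcg, hg1, hg2⟩ := encDir_shape (hU.1 Z hZ g) (hfc g) (hE g)
  obtain ⟨hcj, hj1, hj2⟩ := encDir_shape (hU.1 Z hZ j) (hfc j) (hE j)
  rcases adapted_cases_of_shape hcg hg1 hg2 hk with rfl | rfl
  · rcases adapted_cases_of_shape hcj hj1 hj2 hk' with rfl | rfl
    · exfalso
      apply hne
      have hgc : (Z g).1 + absCharge (Z g) = h := hL.1 Z hZ g
      have hjc : (Z j).1 + absCharge (Z j) = h := hL.1 Z hZ j
      rw [(coord_of_shape hg1 hg2).1, (coord_of_shape hj1 hj2).1, ← absCharge_eq_cabs_of_shape hcg hg1 hg2,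
        ← absCharge_eq_cabs_of_shape hcj hj1 hj2, hgc, hjc]
    · exact Or.inr (Or.inl (hset j))
  · exact Or.inl (hset g)

/-- **RULE D-N AT A FULLY CHARGED `N`-CELL OF A LINE SUPPORT ⟺ ITS FOUR OUTWARD DROPS ARE PRESENT** (the `N`-side normal form; the
`P`-side is LINE 5's `ruleDP_ceiling_iff_lifts`). -/
theorem ruleDN_line_fc_iff_drops (hU : C.InDiamond h) (hL : LineSupport h C) {Z : MCell} (hZ : Z ∈ C.lower)
    (hfc : ∀ f, ¬ isApex (Z f)) (u : Fin 4 → Fin 4) (hE : ∀ f, EncDir (Z f) (u f)) :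
    RuleDMu4N C Z ↔ ∀ j, MServedBelow C Z j (u j + 2) :=
  ⟨fun hD j => line_drop_of_ruleDN hU hL hZ hD (fin4_add_one_ne j) (hfc (j + 1)) (hfc j) (hE j),
    fun hdrop => ruleDN_of_line_drops hU hL hZ hfc u hE hdrop⟩

/-- (dual) on a line support the own coordinate of a charged letter of a `P`-cell is never settled above … -/
theorem own_not_settledAbove (hU : C.InDiamond h) (hL : LineSupport h C) {P : MCell} (hP : P ∈ C.upper) {g : Fin 4}
    (hna : ¬ isApex (P g)) {u : Fin 4} (hE : EncDir (P g) u) : ¬ SettledAbove C P g u := by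
  rintro ⟨r, hr, N, hN, -, hlt, hray⟩
  exact hr (line_partner_dir_above (hU.2 P hP g) (hL.2 P hP g) hna hE (hU.1 N hN g) hlt hray)

/-- … nor coverable above. -/
theorem own_not_coveredAbove (hU : C.InDiamond h) (hL : LineSupport h C) {P : MCell} (hP : P ∈ C.upper) {g : Fin 4}
    (hna : ¬ isApex (P g)) {u : Fin 4} (hE : EncDir (P g) u) (j k' : Fin 4) : ¬ CoveredAbove C P g u j k' := by
  rintro ⟨a, b, hdir, -, N, hN, -, hlt, hray, -⟩
  rcases hdir with rfl | ⟨hap, -⟩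
  · exact fin4_ne_add_two _ (line_partner_dir_above (hU.2 P hP g) (hL.2 P hP g) hna hE (hU.1 N hN g) hlt hray)
  · exact hna hap

/-- **THE `P`-RULE OF THE LINE GAME (kernel)**: at a `P`-cell passing RULE D-P with charged letters on two factors `g ≠ j`, the factor `j` is
served above in its antipodal direction: the LIFT `P[j ↦ shallower letter ∕ apex]` is present (control §16 ∕ LINE 5, restated). -/
theorem line_lift_of_ruleDP (hU : C.InDiamond h) (hL : LineSupport h C) {P : MCell} (hP : P ∈ C.upper) (hD : RuleDMu4P C P)
    {g j : Fin 4} (hgj : g ≠ j) (hg : ¬ isApex (P g)) (hj : ¬ isApex (P j)) {v : Fin 4} (hEj : EncDir (P j) v) :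
    MServedAbove C P j (v + 2) := by
  obtain ⟨u, hEg⟩ := exists_encDir (hU.2 P hP g) hg
  obtain ⟨hcg, hg1, hg2⟩ := encDir_shape (hU.2 P hP g) hg hEg
  obtain ⟨hcj, hj1, hj2⟩ := encDir_shape (hU.2 P hP j) hj hEj
  have hgc : (P g).1 + absCharge (P g) = h := hL.2 P hP g
  have hjc : (P j).1 + absCharge (P j) = h := hL.2 P hP j
  rw [absCharge_eq_cabs_of_shape hcg hg1 hg2] at hgc
  rw [absCharge_eq_cabs_of_shape hcj hj1 hj2] at hjc
  have hne : coord (P j) (v + 2) ≠ coord (P g) u := by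
    rw [(coord_of_shape hj1 hj2).2, (coord_of_shape hg1 hg2).1]; omega
  obtain ⟨r, -, N, hN, hNa⟩ := settledAbove_of_stuck hD (adapted_of_shape hg1 hg2).1 (own_not_settledAbove hU hL hP hg hEg)
    (own_not_coveredAbove hU hL hP hg hEg) hgj.symm (adapted_of_shape hj1 hj2).2 hne
  have hr := line_partner_dir_above (hU.2 P hP j) (hL.2 P hP j) hj hEj (hU.1 N hN j) hNa.2.1 hNa.2.2
  subst hr
  exact ⟨N, hN, hNa⟩

/-- on a line support the APEX factor of a `P`-cell is never served above (nothing of `◇_h` lies above `hI`). -/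
theorem apex_not_servedAbove (hU : C.InDiamond h) (hL : LineSupport h C) {P : MCell} (hP : P ∈ C.upper) {g : Fin 4}
    (hap : isApex (P g)) (k : Fin 4) : ¬ MServedAbove C P g k := by
  rintro ⟨N, hN, -, hlt, -⟩
  have h1 : (P g).1 + absCharge (P g) = h := hL.2 P hP g
  have h2 : (N g).1 + absCharge (N g) ≤ h := (hU.1 N hN g).2.2.2
  have h3 : (0 : ℤ) ≤ absCharge (N g) := abs_nonneg _
  have h4 : absCharge (P g) = 0 := by
    have := hap; simp only [isApex] at this; simp [absCharge, chargeOf, this.1, this.2]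
  omega

/-- **THE `P`-RULE OF THE LINE GAME, COMPLETE (kernel): on a line support EVERY charged letter of EVERY `P`-cell passing RULE D-P is lifted** —
the other factor `g` is either charged (`line_lift_of_ruleDP`) or the apex `hI`, whose coordinates are stuck above as well. (No `N`-analogue: the
apex factor of an `N`-cell can be served below, and the tree's RULE D-N then allows covers — the `X∞`-type escapes of the census.) -/
theorem line_lift_of_ruleDP' (hU : C.InDiamond h) (hL : LineSupport h C) {P : MCell} (hP : P ∈ C.upper) (hD : RuleDMu4P C P)
    {j : Fin 4} (hj : ¬ isApex (P j)) {v : Fin 4} (hEj : EncDir (P j) v) : MServedAbove C P j (v + 2) := by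
  by_cases hg : isApex (P (j + 1))
  · obtain ⟨hcj, hj1, hj2⟩ := encDir_shape (hU.2 P hP j) hj hEj
    have hjc : (P j).1 + absCharge (P j) = h := hL.2 P hP j
    rw [absCharge_eq_cabs_of_shape hcj hj1 hj2] at hjc
    have hgc : (P (j + 1)).1 + absCharge (P (j + 1)) = h := hL.2 P hP (j + 1)
    have hg0 : absCharge (P (j + 1)) = 0 := by
      have := hg; simp only [isApex] at this; simp [absCharge, chargeOf, this.1, this.2]
    have had : Adapted (P (j + 1)) 0 := by
      have := hg; simp only [isApex] at this; simp [Adapted, this.2]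
    have hne : coord (P j) (v + 2) ≠ coord (P (j + 1)) 0 := by
      rw [(coord_of_shape hj1 hj2).2]
      have : coord (P (j + 1)) 0 = (P (j + 1)).1 + (P (j + 1)).2.1 := by simp [coord]
      rw [this, hg.1]; omega
    have hstuck : ¬ SettledAbove C P (j + 1) 0 := by
      rintro ⟨r, -, hs⟩; exact apex_not_servedAbove hU hL hP hg r hs
    have hnocov : ∀ j' k', ¬ CoveredAbove C P (j + 1) 0 j' k' := by
      rintro j' k' ⟨a, b, -, -, N, hN, -, hlt, -, -⟩
      have h1 : (P (j + 1)).1 + absCharge (P (j + 1)) = h := hgc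
      have h2 : (N (j + 1)).1 + absCharge (N (j + 1)) ≤ h := (hU.1 N hN (j + 1)).2.2.2
      have h3 : (0 : ℤ) ≤ absCharge (N (j + 1)) := abs_nonneg _
      omega
    obtain ⟨r, -, N, hN, hNa⟩ := settledAbove_of_stuck hD had hstuck hnocov (fin4_add_one_ne j).symm (adapted_of_shape hj1 hj2).2 hne
    have hr := line_partner_dir_above (hU.2 P hP j) (hL.2 P hP j) hj hEj (hU.1 N hN j) hNa.2.1 hNa.2.2
    subst hr
    exact ⟨N, hN, hNa⟩
  · exact line_lift_of_ruleDP hU hL hP hD (fin4_add_one_ne j) hg hj hEj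

end LineRules

/-! ## §6″ `X+` on a line support fires only under an APEX parent (kernel)

The `X+` family is the dual-world `X` family (`XPlusClosed C = XresXClosed (C.dual 0)`). Read back in original coordinates an `X+` instance
consists of a parent `q ∈ lower` and two `P`-children `Z, n ∈ upper` strictly below it on one factor `σ`, reached from `q_σ` along two DIFFERENT
directions `u ≠ w` (`UPartner`, `Sibling`, transported by the tree's `uPartner_dual` ∕ `ray_dual_iff`). On a line support a CHARGED `q_σ` has all its
lower on-line partners on its single ray (§3 `line_partner_dir_below`: direction `v + 2` only), so `u = w` — contradiction: the parent letter is
the APEX `hI`. Hence the whole `X+` content of the line game is RIVALRY UNDER APEX PARENTS (the situation of control's B1OddTowerLaws §19–§23). No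
breaker (`NoCompanion`, (H-e′), (H-b), `W_f = ∅`) is used. -/

section XPlusLine

variable {h : ℤ} {C : MConfig}

/-- **`X+` ON A LINE SUPPORT FIRES ONLY UNDER AN APEX PARENT** (stated on the dual-world instance, as `XPlusClosed` quantifies it). -/
theorem xPlus_parent_apex_of_lineSupport (hU : C.InDiamond h) (hL : LineSupport h C) {Z' q' n' : MCell} {σ u w f : Fin 4}
    (hZ' : Z' ∈ (C.dual 0).lower) (hq' : q' ∈ (C.dual 0).upper) (hn' : n' ∈ (C.dual 0).lower)
    (hF : XresXFires (C.dual 0) Z' q' n' σ u w f) : isApex (q' σ) := by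
  have hZ : dualCell 0 Z' ∈ C.upper := mem_dual_lower.mp hZ'
  have hq : dualCell 0 q' ∈ C.lower := mem_dual_upper.mp hq'
  have hn : dualCell 0 n' ∈ C.upper := mem_dual_lower.mp hn'
  obtain ⟨-, -, hUP, -, hwu, hSib, -⟩ := hF
  -- the head `Z` lies below the parent `q` on `σ`, reached from `q_σ`… i.e. `q_σ = Z_σ + d·n_u`
  have hUP' : UPartner (dualCell 0 (dualCell 0 Z')) (dualCell 0 (dualCell 0 q')) σ u := by
    rw [dualCell_dualCell, dualCell_dualCell]; exact hUP
  have hZq : UPartner (dualCell 0 q') (dualCell 0 Z') σ u := (uPartner_dual 0 _ _ σ u).mp hUP'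
  -- the sibling `n` lies below `q` on `σ` with `q_σ = n_σ + e·n_w`
  have hnq : ((dualCell 0 n') σ).1 < ((dualCell 0 q') σ).1 ∧
      (dualCell 0 q') σ = ray ((dualCell 0 n') σ) w (((dualCell 0 q') σ).1 - ((dualCell 0 n') σ).1) := by
    apply (ray_dual_iff 0 ((dualCell 0 q') σ) ((dualCell 0 n') σ) w).mp
    have e1 : dualPt 0 ((dualCell 0 q') σ) = q' σ := dualPt_dualPt 0 _
    have e2 : dualPt 0 ((dualCell 0 n') σ) = n' σ := dualPt_dualPt 0 _
    rw [e1, e2]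
    exact ⟨hSib.2.1, hSib.2.2⟩
  by_contra hnap
  have hnap' : ¬ isApex ((dualCell 0 q') σ) := fun h' => hnap ((isApex_dual 0 (q' σ)).mp h')
  obtain ⟨v, hEv⟩ := exists_encDir (hU.1 _ hq σ) hnap'
  have hu : u = v + 2 :=
    line_partner_dir_below (hU.1 _ hq σ) (hL.1 _ hq σ) hnap' hEv (hU.2 _ hZ σ) (hL.2 _ hZ σ) hZq.2.1 hZq.2.2
  have hw : w = v + 2 :=
    line_partner_dir_below (hU.1 _ hq σ) (hL.1 _ hq σ) hnap' hEv (hU.2 _ hn σ) (hL.2 _ hn σ) hnq.1 hnq.2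
  exact hwu (hw.trans hu.symm)

end XPlusLine

/-! ## §6 `decide` probes: the census cells are line cells (names: `ℓ₁, ℓ_i, ℓ₋₁, ℓ₋ᵢ` = phases `0, 1, 2, 3`; `tI + cℓ_u = diamondLetter t c u`) -/

/-- the antipodal `2+2` ceiling cell `P[8I+ℓ₋₁²|8I+ℓ₁²]` (R18.44, SAT at ◇₁₀ with a 14-orbit LINE support, model 7811233cc7321645). -/
def antipodalCell : MCell := ![diamondLetter 8 1 2, diamondLetter 8 1 2, diamondLetter 8 1 0, diamondLetter 8 1 0]
/-- the odd top cell `P[8I+ℓ₋₁³|8I+ℓ_{±i}]` (B-oddcu, UNSAT at ◇₁₀: residual instrument + kit j322459 STAGE B; MUS 38 cells, files 2e3b5ceb551ca011 ∕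
6ba5e4d19b1b2145 — the two mirror images; here phase index `1`, its `Δ²`-mirror is phase `3`). -/
def oddTopCell : MCell := ![diamondLetter 8 1 2, diamondLetter 8 1 2, diamondLetter 8 1 2, diamondLetter 8 1 1]
/-- the even antipodal-mix top cell `P[8I+ℓ₋₁³|8I+ℓ₁]` (C-antimix31, UNSAT ×2 at ◇₁₀, kit j322459 STAGE C cadical+drat-trim VERIFIED; MUS 23 cells
5846cfa341714226). -/
def antimix31Cell : MCell := ![diamondLetter 8 1 2, diamondLetter 8 1 2, diamondLetter 8 1 2, diamondLetter 8 1 0]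
/-- the `◇₈` line cell `P[6I+ℓ₋₁]⁴` (W17: the only SAT fully-charged orbit of ◇₈; realised by the 8-orbit staircase of height 8). -/
def cu8Cell : MCell := ![diamondLetter 6 1 2, diamondLetter 6 1 2, diamondLetter 6 1 2, diamondLetter 6 1 2]
/-- the deep line cell `P[6I+2ℓ₋₁]⁴` of ◇₁₀ (SAT, 8-orbit staircase incl. the corner `5ℓ₋₁`). -/
def cu10DeepCell : MCell := ![diamondLetter 6 2 2, diamondLetter 6 2 2, diamondLetter 6 2 2, diamondLetter 6 2 2]
/-- a staircase `N`-cell of the antipodal support: `N[2I+4ℓ₋₁|10I|10I|10I]` (model 7811233cc7321645, line 3). -/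
def stairNCell : MCell := ![diamondLetter 2 4 2, diamondLetter 10 0 0, diamondLetter 10 0 0, diamondLetter 10 0 0]
/-- the floor corner cell `P[5ℓ₋₁|10I|10I|10I]` of the same support: on the floor AND on the ceiling line of height 10. -/
def cornerCell : MCell := ![diamondLetter 0 5 2, diamondLetter 10 0 0, diamondLetter 10 0 0, diamondLetter 10 0 0]

theorem census_cells_on_line :
    (∀ f, OnCeiling 10 (antipodalCell f)) ∧ (∀ f, OnCeiling 10 (oddTopCell f)) ∧ (∀ f, OnCeiling 10 (antimix31Cell f)) ∧
      (∀ f, OnCeiling 8 (cu8Cell f)) ∧ ¬ (∀ f, OnCeiling 10 (cu8Cell f)) ∧ (∀ f, OnCeiling 10 (cu10DeepCell f)) ∧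
      (∀ f, OnCeiling 10 (stairNCell f)) ∧ (∀ f, OnCeiling 10 (cornerCell f)) ∧ OnFloor (cornerCell 0) :=
  ⟨by decide, by decide, by decide, by decide, by decide, by decide, by decide, by decide, by decide⟩

/-- … and they lie in the diamonds of the stated heights (the ◇₈ cell in `◇₈`, hence in `◇₁₀`). -/
theorem census_cells_inDiamond :
    antipodalCell.InDiamond 10 ∧ oddTopCell.InDiamond 10 ∧ antimix31Cell.InDiamond 10 ∧ cu8Cell.InDiamond 8 ∧
      cu10DeepCell.InDiamond 10 ∧ stairNCell.InDiamond 10 ∧ cornerCell.InDiamond 10 :=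
  ⟨by decide, by decide, by decide, by decide, by decide, by decide, by decide⟩

/-- the two `B-oddcu` survivors are ODD fully-charged cells (here `+i`; `−i` is its mirror); the antipodal `2+2` cell, the antipodal-mix
`3+1` cell and the constant cells are fully charged and EVEN; the staircase `N`-cell is not fully charged. -/
theorem census_cells_parity :
    (FCc oddTopCell ∧ OddPat oddTopCell.pat) ∧ (FCc antipodalCell ∧ ¬ OddPat antipodalCell.pat) ∧
      (FCc antimix31Cell ∧ ¬ OddPat antimix31Cell.pat) ∧ (FCc cu10DeepCell ∧ ¬ OddPat cu10DeepCell.pat) ∧ ¬ FCc stairNCell :=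
  ⟨by decide, by decide, by decide, by decide, by decide⟩

/-- the `+2I` boost of the ◇₈ line cell is the ◇₁₀ line cell `P[8I+ℓ₋₁]⁴` (census: realised WITHOUT a corner letter = boosted staircase). -/
theorem cu8Cell_boost : cu8Cell.boost 2 = ![diamondLetter 8 1 2, diamondLetter 8 1 2, diamondLetter 8 1 2, diamondLetter 8 1 2] := by
  decide

end Summit.HodgeConjecture.HodgeConjecture.Cruxes.BlochSeedDiscOne.CeilingLine
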